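import Summits.QuantumFields.YangMills.Theorems.BalabanLadderIRColdPurityBridge
import Summits.QuantumFields.YangMills.Theorems.BalabanLadderIRDefectSquaringSharp
import Summits.QuantumFields.YangMills.Theorems.BalabanLadderIRColdDefectContinuous
import HarnessLib

/-!
# Transport of purity along the coupling axis (helper for crux `BalabanLadder.IR`, stmt-QuantumFields-19354)

Def-free, per-representation kernel content of the ideator lines `coupling-clopen` and `lipschitz-chain`
(seat ym-ir-idea-12 g0, lens «wuc»; workfiles `Cruxes/IR/Lines/coupling_clopen.lean` rev 4, `Cruxes/IR/Lines/lipschitz_chain.lean`;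
critic ym-ir-crit-3 `VERDICT-coupling-clopen.md` ∕ `VERDICT-lipschitz-chain.md` = PASS-WITH-PRICE, «the topology is real … land S and the
clopen theorem»; landed under RULING g9-№2).  Throughout `δᶜ_β(L) = ColdPurityBridge.coldDefect r.ρ β L` is the cold `4:1` purity defect and
the exit tolerance is the SHARP one, `2⁻²⁴ = 1/(16·2²⁰)` (`AspectBootstrap.coldDefect_sq_le_two_pow`).  For a fixed `LatticeRep r`:

* `decay_of_exit` — an exit `δᶜ_β(Ls) ≤ 2⁻²⁴` (`Ls ≥ 8`, `β ≥ 0`) forces `δᶜ_β(P) ≤ 2⁻²⁰·e^{−(P+1)/Ls}` for all `P ≥ 2Ls`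
  (the proved recursion R iterated: tree `defect_decay_of_recursion`); `eventuallyPure_of_exit` — hence `δᶜ_β(P) ≤ ε` at large `P`.
* `allExit_of_clopen` — CLOPEN TRANSPORT: if exiting couplings are unbounded (K1) and on every compact coupling range beyond `β₁` ONE scale
  purifies every exiting coupling strictly below the tolerance (K2), then EVERY coupling beyond `β₁` exits — the exit set is closed and open in
  each `[β, b₀]`, which is preconnected (the landed `continuous_coldDefect`, `BalabanLadderIRColdDefectContinuous`).
* `exitScaleTame_of_allExit` — the CONVERSE: if every coupling beyond `β₁ ≥ 0` exits, then on every compact range ONE common scale purifies all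
  couplings to any `η > 0` (compactness + continuity + `decay_of_exit`).  So «all exit» ⇔ K1 ∧ K2 exactly, modulo proved facts.
* `allExit_of_lipschitz` — CHAIN TRANSPORT: K1 plus a tail-uniform Lipschitz modulus of `b ↦ δᶜ_b(L)` on compact ranges (LIP) give
  «all exit» by a finite chain of radius `2⁻²⁵/M`.

HONESTY.  Nothing here proves the Yang–Mills mass gap (Clay), a lattice gap, `BalabanLadder.IR`, or any open item (E, K1, K2, LIP, X, N
stay open); R4 closes only the conditional finite-𝕋⁴ rung `BalabanLadder.UV`.  These are transports: they move purity along the coupling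
axis, they never create it.
-/

noncomputable section

open Filter Topology MeasureTheory
open Literature.MathematicalPhysics.QuantumFieldTheory Literature.MathematicalPhysics.QuantumLattice
open Summit.QuantumFields.YangMills.Cruxes.IR.ColdPurityBridge (coldDefect)
open Summit.QuantumFields.YangMills.Cruxes.IR.AspectBootstrap (coldDefect_sq_le_two_pow)
open Summit.QuantumFields.YangMills.Theorems.DoublingDefect (coldDefect_nonneg defect_decay_of_recursion)

namespace Summit.QuantumFields.YangMills.Cruxes.IR.CouplingAxis

variable {G : Type} [Group G] [TopologicalSpace G] [IsTopologicalGroup G] [CompactSpace G]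
  [MeasurableSpace G] [BorelSpace G]

/-- **Decay from an exit.**  If `δᶜ_β(Ls) ≤ 2⁻²⁴` at some `Ls ≥ 8` (`β ≥ 0`), then `δᶜ_β(P) ≤ (2²⁰)⁻¹·exp(−(P+1)/Ls)` for every
`P ≥ 2·Ls` — the sharp recursion `coldDefect_sq_le_two_pow` fed to `defect_decay_of_recursion`. -/
theorem decay_of_exit (r : LatticeRep G) {β : ℝ} (hβ0 : 0 ≤ β) {Ls : ℕ} (hLs8 : 8 ≤ Ls)
    (hex : coldDefect r.ρ β Ls ≤ 1 / 2 ^ 24) :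
    ∀ P : ℕ, 2 * Ls ≤ P → coldDefect r.ρ β P ≤ ((2 : ℝ) ^ 20)⁻¹ * Real.exp (-(((P : ℝ) + 1) / Ls)) := by
  haveI : SecondCountableTopology G :=
    (r.continuous.isClosedEmbedding r.injective).isEmbedding.secondCountableTopology
  have hC : (0 : ℝ) < 2 ^ 20 := by positivity
  have hrec : ∀ M : ℕ, 8 ≤ M → ∀ M' : ℕ, 2 * M ≤ M' → M' ≤ 4 * M →
      coldDefect r.ρ β M' ≤ 2 ^ 20 * coldDefect r.ρ β M ^ 2 := fun M hM M' h1 h2 =>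
    coldDefect_sq_le_two_pow r hβ0 M hM M' h1 h2
  have hnn : ∀ M : ℕ, 8 ≤ M → 0 ≤ coldDefect r.ρ β M := fun M hM => by
    haveI : NeZero M := ⟨by omega⟩
    exact coldDefect_nonneg r.continuous r.mem_unitary hβ0 M (M / 4) (by omega)
  have hex' : coldDefect r.ρ β Ls ≤ 1 / (16 * 2 ^ 20) := hex.trans (by norm_num)
  exact defect_decay_of_recursion (δ := coldDefect r.ρ β) (L₀ := 8) (Ls := Ls) hC hrec hnn hLs8 (by omega) hex'

/-- **An exit is eventually pure at every tolerance.**  From `δᶜ_β(L) ≤ 2⁻²⁴` (`L ≥ 8`, `β ≥ 0`): for every `ε > 0` and every `L₁`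
there is `P ≥ max L₁ 8` with `δᶜ_β(P) ≤ ε`. -/
theorem eventuallyPure_of_exit (r : LatticeRep G) {β : ℝ} (hβ0 : 0 ≤ β) {L : ℕ} (hL8 : 8 ≤ L)
    (hex : coldDefect r.ρ β L ≤ 1 / 2 ^ 24) {ε : ℝ} (hε : 0 < ε) (L₁ : ℕ) :
    ∃ P : ℕ, L₁ ≤ P ∧ 8 ≤ P ∧ coldDefect r.ρ β P ≤ ε := by
  have hdec := decay_of_exit r hβ0 hL8 hex
  have hL0 : (0 : ℝ) < L := by exact_mod_cast (by omega : 0 < L)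
  have h1 : Tendsto (fun P : ℕ => (((P : ℝ) + 1) / L)) atTop atTop :=
    Tendsto.atTop_div_const hL0 (tendsto_atTop_add_const_right _ _ tendsto_natCast_atTop_atTop)
  have h2 : Tendsto (fun P : ℕ => ((2 : ℝ) ^ 20)⁻¹ * Real.exp (-(((P : ℝ) + 1) / L))) atTop
      (𝓝 (((2 : ℝ) ^ 20)⁻¹ * 0)) :=
    (Real.tendsto_exp_neg_atTop_nhds_zero.comp h1).const_mul _
  rw [mul_zero] at h2
  obtain ⟨P₀, hP₀⟩ := eventually_atTop.1 ((tendsto_order.1 h2).2 ε hε)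
  refine ⟨max P₀ (max (2 * L) L₁), le_trans (le_max_right _ _) (le_max_right _ _), by omega, ?_⟩
  have hP2 : 2 * L ≤ max P₀ (max (2 * L) L₁) := le_trans (le_max_left _ _) (le_max_right _ _)
  exact (hdec _ hP2).trans (hP₀ _ (le_max_left _ _)).le

/-- **Clopen transport along the coupling axis.**  Fix tolerances `η < ε`.  If exiting couplings are unbounded
(K1: `∀ b ∃ β ≥ b ∃ L ≥ 8, δᶜ_β(L) ≤ ε`) and on every compact range beyond `β₁` ONE scale `P ≥ 8` purifies every exiting coupling to `η`
(K2), then EVERY coupling `β > β₁` exits at tolerance `ε`: in `[β, b₀]` (`b₀` exiting) the exit set contains the closed set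
`{δᶜ(P) ≤ η}` ⊇ exits and the open set `{δᶜ(P) < ε}` ⊆ exits, and `[β, b₀]` is preconnected.  Pure topology + the landed `continuous_coldDefect`. -/
theorem allExit_of_clopen (r : LatticeRep G) {β₁ ε η : ℝ} (hηε : η < ε)
    (hK1 : ∀ b : ℝ, ∃ β : ℝ, b ≤ β ∧ ∃ L : ℕ, 8 ≤ L ∧ coldDefect r.ρ β L ≤ ε)
    (hK2 : ∀ u v : ℝ, β₁ < u → u ≤ v → ∃ P : ℕ, 8 ≤ P ∧ ∀ β : ℝ, u ≤ β → β ≤ v →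
      (∃ L : ℕ, 8 ≤ L ∧ coldDefect r.ρ β L ≤ ε) → coldDefect r.ρ β P ≤ η) :
    ∀ β : ℝ, β₁ < β → ∃ L : ℕ, 8 ≤ L ∧ coldDefect r.ρ β L ≤ ε := by
  intro β hβ
  obtain ⟨b₀, hb₀, hgood₀⟩ := hK1 (β + 1)
  have hβb : β ≤ b₀ := by linarith
  obtain ⟨P, hP8, hP⟩ := hK2 β b₀ hβ hβb
  have hcont : Continuous fun b : ℝ => coldDefect r.ρ b P := continuous_coldDefect r P
  set s : Set ℝ := {b : ℝ | coldDefect r.ρ b P ≤ η} with hs_def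
  set o : Set ℝ := {b : ℝ | coldDefect r.ρ b P < ε} with ho_def
  have hs : IsClosed s := isClosed_le hcont continuous_const
  have ho : IsOpen o := isOpen_lt hcont continuous_const
  have ho_ex : ∀ b : ℝ, b ∈ o → ∃ L : ℕ, 8 ≤ L ∧ coldDefect r.ρ b L ≤ ε := fun b hb => ⟨P, hP8, le_of_lt hb⟩
  have hs_o : ∀ b : ℝ, b ∈ s → b ∈ o := fun b hb => by
    have hb' : coldDefect r.ρ b P ≤ η := hb
    show coldDefect r.ρ b P < ε
    linarith
  by_contra hne
  have hβo : β ∉ o := fun h => hne (ho_ex β h)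
  have hcover : Set.Icc β b₀ ⊆ s ∪ oᶜ := by
    intro b hb
    by_cases h : b ∈ o
    · exact Or.inl (hP b hb.1 hb.2 (ho_ex b h))
    · exact Or.inr h
  have hb₀s : b₀ ∈ s := hP b₀ hβb le_rfl hgood₀
  obtain ⟨b, -, hbs, hbo⟩ := (isPreconnected_closed_iff.1 isPreconnected_Icc) s oᶜ hs ho.isClosed_compl hcover
    ⟨b₀, ⟨hβb, le_rfl⟩, hb₀s⟩ ⟨β, ⟨le_rfl, hβb⟩, hβo⟩
  exact hbo (hs_o b hbs)

/-- **The converse: all-exit ⇒ one common purifying scale on every compact range** (compactness + continuity + decay).  If every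
coupling beyond `β₁ ≥ 0` exits at the sharp tolerance `2⁻²⁴`, then for every `η > 0` and every compact range `[u, v] ⊂ (β₁, ∞)` ONE scale
`P ≥ 8` gives `δᶜ_β(P) ≤ η` for ALL `β ∈ [u, v]`: each `b` has a strict exit scale `Q_b` (`eventuallyPure_of_exit`), hence an open
neighbourhood exiting at `Q_b`; finitely many cover `[u, v]`; `decay_of_exit` from each `Q_{b_i}` and one `P` large for all `i`. -/
theorem exitScaleTame_of_allExit (r : LatticeRep G) {β₁ : ℝ} (hβ₁ : 0 ≤ β₁)
    (hAll : ∀ β : ℝ, β₁ < β → ∃ L : ℕ, 8 ≤ L ∧ coldDefect r.ρ β L ≤ 1 / 2 ^ 24) {η : ℝ} (hη : 0 < η) :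
    ∀ u v : ℝ, β₁ < u → u ≤ v → ∃ P : ℕ, 8 ≤ P ∧ ∀ β : ℝ, u ≤ β → β ≤ v → coldDefect r.ρ β P ≤ η := by
  intro u v hu huv
  have hu0 : 0 ≤ u := hβ₁.trans hu.le
  have htol : (0 : ℝ) < 1 / 2 ^ 24 := by positivity
  -- a strict exit scale at every coupling of the range
  have hloc : ∀ b : Set.Icc u v, ∃ Q : ℕ, 8 ≤ Q ∧ coldDefect r.ρ (b : ℝ) Q < 1 / 2 ^ 24 := by
    intro b
    have hb1 : β₁ < (b : ℝ) := lt_of_lt_of_le hu b.2.1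
    have hb0 : 0 ≤ (b : ℝ) := hu0.trans b.2.1
    obtain ⟨L, hL8, hL⟩ := hAll (b : ℝ) hb1
    obtain ⟨Q, -, hQ8, hQ⟩ := eventuallyPure_of_exit r hb0 hL8 hL (half_pos htol) 0
    exact ⟨Q, hQ8, by linarith⟩
  choose Q hQ8 hQlt using hloc
  -- open cover of the compact range by «exits strictly at scale Q i»
  set U : Set.Icc u v → Set ℝ := fun i => {c : ℝ | coldDefect r.ρ c (Q i) < 1 / 2 ^ 24} with hU_def
  have hUo : ∀ i, IsOpen (U i) := fun i => isOpen_lt (continuous_coldDefect r (Q i)) continuous_const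
  have hcov : Set.Icc u v ⊆ ⋃ i, U i := fun b hb => Set.mem_iUnion.2 ⟨⟨b, hb⟩, hQlt ⟨b, hb⟩⟩
  obtain ⟨t, ht⟩ := isCompact_Icc.elim_finite_subcover U hUo hcov
  -- one common scale for the finitely many decay laws
  have hev : ∀ i : Set.Icc u v, ∀ᶠ P : ℕ in atTop,
      2 * Q i ≤ P ∧ ((2 : ℝ) ^ 20)⁻¹ * Real.exp (-(((P : ℝ) + 1) / Q i)) < η := by
    intro i
    refine (eventually_ge_atTop (2 * Q i)).and ?_
    have hQ0 : (0 : ℝ) < Q i := by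
      have := hQ8 i
      exact_mod_cast (by omega : 0 < Q i)
    have h1 : Tendsto (fun P : ℕ => (((P : ℝ) + 1) / Q i)) atTop atTop :=
      Tendsto.atTop_div_const hQ0 (tendsto_atTop_add_const_right _ _ tendsto_natCast_atTop_atTop)
    have h2 : Tendsto (fun P : ℕ => ((2 : ℝ) ^ 20)⁻¹ * Real.exp (-(((P : ℝ) + 1) / Q i))) atTop
        (𝓝 (((2 : ℝ) ^ 20)⁻¹ * 0)) :=
      (Real.tendsto_exp_neg_atTop_nhds_zero.comp h1).const_mul _
    rw [mul_zero] at h2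
    exact (tendsto_order.1 h2).2 _ hη
  have hall : ∀ᶠ P : ℕ in atTop, 8 ≤ P ∧ ∀ i ∈ t,
      2 * Q i ≤ P ∧ ((2 : ℝ) ^ 20)⁻¹ * Real.exp (-(((P : ℝ) + 1) / Q i)) < η :=
    (eventually_ge_atTop 8).and ((Filter.eventually_all_finset t).2 fun i _ => hev i)
  obtain ⟨P, hP8, hPt⟩ := hall.exists
  refine ⟨P, hP8, fun β hβu hβv => ?_⟩
  have hmem : β ∈ ⋃ i ∈ t, U i := ht ⟨hβu, hβv⟩
  simp only [Set.mem_iUnion] at hmem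
  obtain ⟨i, hi, hβi⟩ := hmem
  have hβ0 : 0 ≤ β := hu0.trans hβu
  obtain ⟨h2Q, hlt⟩ := hPt i hi
  exact (decay_of_exit r hβ0 (hQ8 i) (le_of_lt hβi) P h2Q).trans hlt.le

/-- **Chain transport along the coupling axis.**  If exiting couplings are unbounded at the sharp tolerance (K1) and beyond `β₁ ≥ 0`
the map `b ↦ δᶜ_b(L)` has a tail-uniform Lipschitz modulus on every compact range (LIP: `∃ M, L₁, ∀ L ≥ L₁, |δᶜ_b(L) − δᶜ_{b'}(L)| ≤
M|b − b'|` on `[u, v]`), then every coupling `β > β₁` exits: an exit at `b₁` is `2⁻²⁵`-pure at all large scales (`eventuallyPure_of_exit`),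
so every `b` within `2⁻²⁵/M` of it exits at a large scale; a finite chain from an exiting `b₀ ≥ β + 1` reaches `β`. -/
theorem allExit_of_lipschitz (r : LatticeRep G) {β₁ : ℝ} (hβ₁ : 0 ≤ β₁)
    (hK1 : ∀ b : ℝ, ∃ β : ℝ, b ≤ β ∧ ∃ L : ℕ, 8 ≤ L ∧ coldDefect r.ρ β L ≤ 1 / 2 ^ 24)
    (hLip : ∀ u v : ℝ, β₁ < u → u ≤ v → ∃ M : ℝ, ∃ L₁ : ℕ, 0 < M ∧ ∀ L : ℕ, L₁ ≤ L →
      ∀ b b' : ℝ, u ≤ b → b ≤ v → u ≤ b' → b' ≤ v →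
        |coldDefect r.ρ b L - coldDefect r.ρ b' L| ≤ M * |b - b'|) :
    ∀ β : ℝ, β₁ < β → ∃ L : ℕ, 8 ≤ L ∧ coldDefect r.ρ β L ≤ 1 / 2 ^ 24 := by
  intro β hβ
  have hβ0 : 0 ≤ β := hβ₁.trans hβ.le
  obtain ⟨b₀, hb₀, hgood₀⟩ := hK1 (β + 1)
  have hβb : β ≤ b₀ := by linarith
  obtain ⟨M, L₁, hM, hlip⟩ := hLip β b₀ hβ hβb
  have htol : (0 : ℝ) < 1 / 2 ^ 24 := by positivity
  set rad : ℝ := (1 / 2 ^ 24) / (2 * M) with hrad_def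
  have hrad : 0 < rad := by positivity
  have hMrad : M * rad = (1 / 2 ^ 24) / 2 := by
    rw [hrad_def]; field_simp
  -- propagation: an exit at `b₁ ∈ [β, b₀]` makes every `b ∈ [β, b₀]` within `rad` exit
  have prop : ∀ b₁ b : ℝ, β ≤ b₁ → b₁ ≤ b₀ → β ≤ b → b ≤ b₀ →
      (∃ L : ℕ, 8 ≤ L ∧ coldDefect r.ρ b₁ L ≤ 1 / 2 ^ 24) → |b - b₁| ≤ rad →
      ∃ L : ℕ, 8 ≤ L ∧ coldDefect r.ρ b L ≤ 1 / 2 ^ 24 := by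
    intro b₁ b h1 h2 h3 h4 hex hdist
    obtain ⟨L, hL8, hδ⟩ := hex
    have hb₁0 : 0 ≤ b₁ := hβ0.trans h1
    obtain ⟨P, hP1, hP8, hP⟩ := eventuallyPure_of_exit r hb₁0 hL8 hδ (half_pos htol) L₁
    have hl := hlip P hP1 b b₁ h3 h4 h1 h2
    refine ⟨P, hP8, ?_⟩
    have habs : coldDefect r.ρ b P - coldDefect r.ρ b₁ P ≤ M * |b - b₁| := le_trans (le_abs_self _) hl
    have hMd : M * |b - b₁| ≤ M * rad := mul_le_mul_of_nonneg_left hdist hM.le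
    linarith
  -- the chain: by induction on the number of steps of length `rad` below `b₀`
  have chain : ∀ n : ℕ, ∀ b : ℝ, β ≤ b → b ≤ b₀ → b₀ - b ≤ n * rad →
      ∃ L : ℕ, 8 ≤ L ∧ coldDefect r.ρ b L ≤ 1 / 2 ^ 24 := by
    intro n
    induction n with
    | zero =>
      intro b h1 h2 h3
      have hb : b = b₀ := by
        simp only [Nat.cast_zero, zero_mul, sub_nonpos] at h3
        exact le_antisymm h2 h3
      rw [hb]; exact hgood₀
    | succ n ih =>
      intro b h1 h2 h3
      by_cases hclose : b₀ - b ≤ rad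
      · exact prop b₀ b hβb le_rfl h1 h2 hgood₀ (by rw [abs_sub_comm, abs_of_nonneg (by linarith)]; exact hclose)
      · have hclose' : rad < b₀ - b := lt_of_not_ge hclose
        have h2' : b + rad ≤ b₀ := by linarith
        have hih := ih (b + rad) (by linarith) h2' (by push_cast at h3 ⊢; linarith)
        exact prop (b + rad) b (by linarith) h2' h1 h2 hih
          (by rw [show b - (b + rad) = -rad by ring, abs_neg, abs_of_pos hrad])
  obtain ⟨n, hn⟩ := exists_nat_ge ((b₀ - β) / rad)
  have hn' : b₀ - β ≤ n * rad := by
    rw [div_le_iff₀ hrad] at hn; exact hn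
  exact chain n β le_rfl hβb hn'

end Summit.QuantumFields.YangMills.Cruxes.IR.CouplingAxis

end
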